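import Mathlib.Analysis.SpecialFunctions.SmoothTransition
import Mathlib.Analysis.SpecialFunctions.Integrals.Basic
import Mathlib.MeasureTheory.Integral.IntervalIntegral.FundThmCalculus
import Mathlib.Analysis.Calculus.ContDiff.Deriv
import HarnessLib

/-!
# Bär–Hanke, Lemma 25 (first half): the profile functions `φ₁` and `ψ₁`

Topic `Literature/Geometry/Riemannian` (namespace `Literature.Geometry.Riemannian.BaerHanke`).
Second brick of the printed proof of the named fact
`Literature.Geometry.Riemannian.BaerHankePscGluing` (`BaerHankeGluing.lean`; Bär–Hanke,
*Boundary conditions for scalar curvature*, §4.4, Thm. 42), along the chain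
Thm. 42 ← Thm. 27 ← Prop. 26 ← Lemma 24 (`BaerHankeTraceComparison.lean`) + **Lemma 25**.

Lemma 25 (arXiv:2012.09127, p. 11) produces the cut-off functions `τ_δ = φ_δ + ψ_δ`,
`φ_δ(t) = δ φ₁(t/δ)`, `ψ_δ(t) = δ ψ₁(t/√δ)`, from two fixed smooth profiles:

* `φ₁ : [0, ∞) → ℝ` smooth and concave with `φ₁(t) = t - 1/2` near `0`, `φ₁ = 0` on
  `[19/20, ∞)`, `-1/2 ≤ φ₁ ≤ 0`, `0 ≤ φ₁' ≤ 1`, `-2 ≤ φ₁'' ≤ 0` (in the paper: "a smooth concave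
  approximation `φ₁` of the `C²`-function `φ̃`");
* `ψ₁ : [0, ∞) → ℝ` smooth with `ψ₁ = 1/2` on `[0, 19/20]`, `ψ₁ = 0` on `[1, ∞)`,
  `0 ≤ ψ₁ ≤ 1/2` (and, being constant off `[19/20, 1]`, with bounded `ψ₁'`, `ψ₁''`).

This file PROVES the existence of two such profiles, as functions on all of `ℝ`
(`BaerHanke.exists_phiOne`, `BaerHanke.exists_psiOne`), with exactly the properties consumed by
the proof of Lemma 25. The paper obtains `φ₁` by an unspecified smooth concave approximation of an
explicit piecewise-polynomial `C²` function; here `φ₁` is built directly (a deviation in the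
construction only, not in the statement): with Mathlib's `Real.smoothTransition` `S` put
`B(t) = S(10t - 1) S(9 - 10t)` (a smooth plateau, `= 1` on `[1/5, 4/5]`, `= 0` off `(1/10, 9/10)`,
symmetric under `t ↦ 1 - t`), `I = ∫₀¹ B ≥ 3/5`, `φ₁' = f = 1 - I⁻¹ ∫₀ᵗ B` and
`φ₁(t) = -1/2 + ∫₀ᵗ f`; then `φ₁'' = -I⁻¹ B ∈ [-5/3, 0]`, `f` decreases from `1` to `0`, and the
symmetry `f(1 - t) = 1 - f(t)` gives `∫₀¹ f = 1/2` exactly, i.e. `φ₁ = 0` from `t = 9/10` on.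
`ψ₁(t) = (1 - S(20t - 19))/2`.

Everything is proved; no definitions and no named facts are introduced (the profiles are
existentially quantified; the assembly of `τ_δ` is `BaerHankeCutoff.lean`).

## References

* [BarHanke2023] C. Bär, B. Hanke, *Boundary conditions for scalar curvature*, in *Perspectives in
  scalar curvature*, Vol. 2, World Sci. 2023, 325–377 = arXiv:2012.09127, §3, Lemma 25 and its
  proof (p. 11 of the arXiv version, READ).
-/

noncomputable section

open Real Set Filter MeasureTheory intervalIntegral
open scoped Topology ContDiff

namespace Literature.Geometry.Riemannian

namespace BaerHanke

/-! ### Two calculus helpers -/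

/-- A continuous real function vanishing off a compact interval is bounded. [folklore] -/
theorem exists_abs_le_of_eq_zero_off {g : ℝ → ℝ} (hg : Continuous g) {a b : ℝ}
    (h : ∀ t, t < a ∨ b < t → g t = 0) : ∃ C, ∀ t, |g t| ≤ C := by
  obtain ⟨C, hC⟩ := (isCompact_Icc (a := a) (b := b)).exists_bound_of_continuousOn
    hg.continuousOn
  refine ⟨max C 0, fun t ↦ ?_⟩
  by_cases ht : t ∈ Icc a b
  · exact ((Real.norm_eq_abs _).symm.le.trans (hC t ht)).trans (le_max_left _ _)
  · have ht' : t < a ∨ b < t := by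
      simp only [mem_Icc, not_and_or, not_le] at ht
      exact ht
    rw [h t ht', abs_zero]
    exact le_max_right _ _

/-- If `g` is constant near `t` then `g'(t) = 0` and `g''(t) = 0`. [folklore] -/
theorem deriv_eq_zero_of_eventually_eq_const {g : ℝ → ℝ} {t c : ℝ}
    (h : g =ᶠ[𝓝 t] fun _ ↦ c) : deriv g t = 0 ∧ deriv (deriv g) t = 0 := by
  refine ⟨by rw [h.deriv_eq, deriv_const], ?_⟩
  have h2 : deriv g =ᶠ[𝓝 t] deriv (fun _ : ℝ ↦ c) := h.deriv
  rw [h2.deriv_eq, deriv_const', deriv_const]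

/-! ### The plateau profile `ψ₁` -/

/-- **The profile `ψ₁` of Bär–Hanke, Lemma 25.** There is a smooth `ψ₁ : ℝ → ℝ` with `ψ₁ = 1/2`
on `(-∞, 19/20]`, `ψ₁ = 0` on `[1, ∞)`, `0 ≤ ψ₁ ≤ 1/2`, whose first and second derivatives
vanish on `(-∞, 19/20)` and are bounded on `ℝ` (namely `ψ₁(t) = (1 - S(20t - 19))/2` with
Mathlib's smooth transition `S`). [cite: BarHanke2023, §3, Lemma 25 (proof)] -/
theorem exists_psiOne : ∃ ψ : ℝ → ℝ, ContDiff ℝ ∞ ψ ∧ (∀ t, t ≤ 19 / 20 → ψ t = 1 / 2) ∧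
    (∀ t, 1 ≤ t → ψ t = 0) ∧ (∀ t, 0 ≤ ψ t ∧ ψ t ≤ 1 / 2) ∧
    (∀ t, t < 19 / 20 → deriv ψ t = 0 ∧ deriv (deriv ψ) t = 0) ∧
    (∃ C, ∀ t, |deriv ψ t| ≤ C) ∧ (∃ C, ∀ t, |deriv (deriv ψ) t| ≤ C) := by
  set ψ : ℝ → ℝ := fun t ↦ 1 / 2 * (1 - smoothTransition (20 * t - 19)) with hψ
  have hsmooth : ContDiff ℝ ∞ ψ := by
    have h1 : ContDiff ℝ ∞ (fun t : ℝ ↦ 20 * t - 19) := by fun_prop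
    exact contDiff_const.mul (contDiff_const.sub (Real.smoothTransition.contDiff.comp h1))
  have hlow : ∀ t, t ≤ 19 / 20 → ψ t = 1 / 2 := fun t ht ↦ by
    have : smoothTransition (20 * t - 19) = 0 :=
      smoothTransition.zero_of_nonpos (by linarith)
    simp [hψ, this]
  have hhigh : ∀ t, 1 ≤ t → ψ t = 0 := fun t ht ↦ by
    have : smoothTransition (20 * t - 19) = 1 :=
      smoothTransition.one_of_one_le (by linarith)
    simp [hψ, this]
  have hbounds : ∀ t, 0 ≤ ψ t ∧ ψ t ≤ 1 / 2 := fun t ↦ by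
    have h0 := smoothTransition.nonneg (20 * t - 19)
    have h1 := smoothTransition.le_one (20 * t - 19)
    simp only [hψ]
    constructor <;> nlinarith
  -- `ψ` is locally constant off `[19/20, 1]`
  have hlow' : ∀ t, t < 19 / 20 → deriv ψ t = 0 ∧ deriv (deriv ψ) t = 0 := fun t ht ↦ by
    refine deriv_eq_zero_of_eventually_eq_const (c := 1 / 2) ?_
    filter_upwards [Iio_mem_nhds ht] with s hs using hlow s hs.le
  have hhigh' : ∀ t, 1 < t → deriv ψ t = 0 ∧ deriv (deriv ψ) t = 0 := fun t ht ↦ by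
    refine deriv_eq_zero_of_eventually_eq_const (c := 0) ?_
    filter_upwards [Ioi_mem_nhds ht] with s hs using hhigh s hs.le
  have hoff1 : ∀ t, t < 19 / 20 ∨ 1 < t → deriv ψ t = 0 := fun t ht ↦
    ht.elim (fun h ↦ (hlow' t h).1) (fun h ↦ (hhigh' t h).1)
  have hoff2 : ∀ t, t < 19 / 20 ∨ 1 < t → deriv (deriv ψ) t = 0 := fun t ht ↦
    ht.elim (fun h ↦ (hlow' t h).2) (fun h ↦ (hhigh' t h).2)
  have hc1 : Continuous (deriv ψ) := hsmooth.continuous_deriv (by exact_mod_cast le_top)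
  have hc2 : Continuous (deriv (deriv ψ)) := by
    have := (hsmooth.iterate_deriv 2).continuous
    simpa using this
  exact ⟨ψ, hsmooth, hlow, hhigh, hbounds, hlow', exists_abs_le_of_eq_zero_off hc1 hoff1,
    exists_abs_le_of_eq_zero_off hc2 hoff2⟩

/-! ### The concave profile `φ₁` -/

/-- **The profile `φ₁` of Bär–Hanke, Lemma 25.** There is a smooth `φ₁ : ℝ → ℝ` with
`φ₁(t) = t - 1/2` for `t ≤ 1/10` ("near `0`"), `φ₁ = 0` on `[9/10, ∞)` (in particular on
`[19/20, ∞)`), `-1/2 ≤ φ₁ ≤ 0` on `[0, ∞)`, `0 ≤ φ₁' ≤ 1` and `-2 ≤ φ₁'' ≤ 0` everywhere (so `φ₁`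
is concave and nondecreasing), and `φ₁' = φ₁'' = 0` on `[9/10, ∞)`. Construction: see the module
docstring (`φ₁' = 1 - I⁻¹ ∫₀ᵗ B`, `B` a symmetric smooth plateau). These are the properties
"`-1/2 ≤ φ₁ ≤ 0`, `-2 ≤ φ̈₁ ≤ 0`, `1 = φ̇₁(0) ≥ φ̇₁(t) ≥ φ̇₁(1) = 0`" used in the proof of
Lemma 25. [cite: BarHanke2023, §3, Lemma 25 (proof)] -/
theorem exists_phiOne : ∃ φ : ℝ → ℝ, ContDiff ℝ ∞ φ ∧ (∀ t, t ≤ 1 / 10 → φ t = t - 1 / 2) ∧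
    (∀ t, 9 / 10 ≤ t → φ t = 0) ∧ (∀ t, 0 ≤ t → -(1 / 2) ≤ φ t ∧ φ t ≤ 0) ∧
    (∀ t, 0 ≤ deriv φ t ∧ deriv φ t ≤ 1) ∧
    (∀ t, -2 ≤ deriv (deriv φ) t ∧ deriv (deriv φ) t ≤ 0) ∧
    (∀ t, 9 / 10 ≤ t → deriv φ t = 0 ∧ deriv (deriv φ) t = 0) := by
  -- the plateau `B`
  set B : ℝ → ℝ := fun t ↦ smoothTransition (10 * t - 1) * smoothTransition (9 - 10 * t) with hB
  have hBsmooth : ContDiff ℝ ∞ B := by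
    have h1 : ContDiff ℝ ∞ (fun t : ℝ ↦ 10 * t - 1) := by fun_prop
    have h2 : ContDiff ℝ ∞ (fun t : ℝ ↦ 9 - 10 * t) := by fun_prop
    exact (Real.smoothTransition.contDiff.comp h1).mul (Real.smoothTransition.contDiff.comp h2)
  have hBcont : Continuous B := hBsmooth.continuous
  have hBint : ∀ a b : ℝ, IntervalIntegrable B volume a b := fun a b ↦ hBcont.intervalIntegrable a b
  have hB01 : ∀ t, 0 ≤ B t ∧ B t ≤ 1 := fun t ↦ by
    have h0 := smoothTransition.nonneg (10 * t - 1)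
    have h1 := smoothTransition.le_one (10 * t - 1)
    have h0' := smoothTransition.nonneg (9 - 10 * t)
    have h1' := smoothTransition.le_one (9 - 10 * t)
    exact ⟨mul_nonneg h0 h0', by nlinarith⟩
  have hBlow : ∀ t, t ≤ 1 / 10 → B t = 0 := fun t ht ↦ by
    have : smoothTransition (10 * t - 1) = 0 := smoothTransition.zero_of_nonpos (by linarith)
    simp [hB, this]
  have hBhigh : ∀ t, 9 / 10 ≤ t → B t = 0 := fun t ht ↦ by
    have : smoothTransition (9 - 10 * t) = 0 := smoothTransition.zero_of_nonpos (by linarith)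
    simp [hB, this]
  have hBmid : ∀ t, 2 / 10 ≤ t → t ≤ 8 / 10 → B t = 1 := fun t ht ht' ↦ by
    have h1 : smoothTransition (10 * t - 1) = 1 := smoothTransition.one_of_one_le (by linarith)
    have h2 : smoothTransition (9 - 10 * t) = 1 := smoothTransition.one_of_one_le (by linarith)
    simp [hB, h1, h2]
  have hBsymm : ∀ t, B (1 - t) = B t := fun t ↦ by
    simp only [hB]
    rw [show 10 * (1 - t) - 1 = 9 - 10 * t by ring, show 9 - 10 * (1 - t) = 10 * t - 1 by ring,
      mul_comm]
  -- the total integral `I` and the primitive `W`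
  set I : ℝ := ∫ s in (0 : ℝ)..1, B s with hI
  set W : ℝ → ℝ := fun t ↦ ∫ s in (0 : ℝ)..t, B s with hW
  have hW1 : W 1 = I := rfl
  have hW0 : W 0 = 0 := by simp [hW]
  have hWderiv : ∀ t, HasDerivAt W (B t) t := fun t ↦
    (hBcont.integral_hasStrictDerivAt 0 t).hasDerivAt
  have hderivW : deriv W = B := funext fun t ↦ (hWderiv t).deriv
  have hWsmooth : ContDiff ℝ ∞ W :=
    contDiff_infty_iff_deriv.mpr ⟨fun t ↦ (hWderiv t).differentiableAt, by rwa [hderivW]⟩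
  have hWcont : Continuous W := hWsmooth.continuous
  -- `W t' - W t = ∫_t^{t'} B`
  have hWsub : ∀ t t', W t' - W t = ∫ s in t..t', B s := fun t t' ↦
    integral_interval_sub_left (hBint 0 t') (hBint 0 t)
  have hWmono : ∀ t t', t ≤ t' → W t ≤ W t' := fun t t' htt' ↦ by
    have := hWsub t t'
    have h0 : 0 ≤ ∫ s in t..t', B s := integral_nonneg htt' fun u _ ↦ (hB01 u).1
    linarith
  have hWlow : ∀ t, t ≤ 1 / 10 → W t = 0 := fun t ht ↦ by
    simp only [hW]
    rw [integral_congr (g := fun _ ↦ (0 : ℝ)) ?_, intervalIntegral.integral_zero]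
    intro s hs
    rcases mem_uIcc.mp hs with ⟨h0s, hst⟩ | ⟨hts, hs0⟩
    · exact hBlow s (hst.trans ht)
    · exact hBlow s (by linarith)
  have hWhigh : ∀ t, 9 / 10 ≤ t → W t = I := fun t ht ↦ by
    have h := hWsub 1 t
    have h0 : ∫ s in (1 : ℝ)..t, B s = 0 := by
      rw [integral_congr (g := fun _ ↦ (0 : ℝ)) ?_, intervalIntegral.integral_zero]
      intro s hs
      rcases mem_uIcc.mp hs with ⟨h1s, _⟩ | ⟨hts, _⟩
      · exact hBhigh s (by linarith)
      · exact hBhigh s (ht.trans hts)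
    rw [h0, hW1] at h
    linarith
  -- `I ≥ 3/5`
  have hIge : 3 / 5 ≤ I := by
    have hsplit1 : (∫ s in (0 : ℝ)..(2 / 10), B s) + ∫ s in (2 / 10 : ℝ)..1, B s = I :=
      integral_add_adjacent_intervals (hBint _ _) (hBint _ _)
    have hsplit2 : (∫ s in (2 / 10 : ℝ)..(8 / 10), B s) + ∫ s in (8 / 10 : ℝ)..1, B s =
        ∫ s in (2 / 10 : ℝ)..1, B s :=
      integral_add_adjacent_intervals (hBint _ _) (hBint _ _)
    have h1 : 0 ≤ ∫ s in (0 : ℝ)..(2 / 10), B s :=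
      integral_nonneg (by norm_num) fun u _ ↦ (hB01 u).1
    have h3 : 0 ≤ ∫ s in (8 / 10 : ℝ)..1, B s :=
      integral_nonneg (by norm_num) fun u _ ↦ (hB01 u).1
    have h2 : ∫ s in (2 / 10 : ℝ)..(8 / 10), B s = 3 / 5 := by
      rw [integral_congr (g := fun _ ↦ (1 : ℝ)) ?_, integral_one]
      · norm_num
      · intro s hs
        rw [uIcc_of_le (by norm_num)] at hs
        exact hBmid s hs.1 hs.2
    linarith
  have hIpos : 0 < I := by linarith
  have hcI : I⁻¹ * I = 1 := inv_mul_cancel₀ hIpos.ne'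
  have hcpos : 0 < I⁻¹ := inv_pos.mpr hIpos
  have hcle : I⁻¹ ≤ 2 := by
    rw [inv_le_comm₀ hIpos two_pos]
    linarith
  -- `0 ≤ W ≤ I`
  have hWnonneg : ∀ t, 0 ≤ W t := fun t ↦ by
    by_cases ht : t ≤ 1 / 10
    · rw [hWlow t ht]
    · rw [← hW0]; exact hWmono 0 t (by linarith)
  have hWle : ∀ t, W t ≤ I := fun t ↦ by
    by_cases ht : 9 / 10 ≤ t
    · rw [hWhigh t ht]
    · rw [← hW1]; exact hWmono t 1 (by linarith)
  -- symmetry `W t + W (1 - t) = I`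
  have hWsymm : ∀ t, W t + W (1 - t) = I := fun t ↦ by
    have h1 : ∫ s in t..1, B (1 - s) = ∫ s in (1 - 1 : ℝ)..(1 - t), B s :=
      integral_comp_sub_left B 1
    have h2 : ∫ s in t..1, B (1 - s) = ∫ s in t..1, B s :=
      integral_congr fun s _ ↦ hBsymm s
    have h3 : W (1 - t) = ∫ s in t..1, B s := by
      simp only [hW]
      rw [← h2, h1, sub_self]
    rw [h3]
    exact integral_add_adjacent_intervals (hBint _ _) (hBint _ _)
  -- the derivative profile `f = φ₁'`
  set f : ℝ → ℝ := fun t ↦ 1 - I⁻¹ * W t with hf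
  have hfsmooth : ContDiff ℝ ∞ f := contDiff_const.sub (contDiff_const.mul hWsmooth)
  have hfcont : Continuous f := hfsmooth.continuous
  have hfint : ∀ a b : ℝ, IntervalIntegrable f volume a b := fun a b ↦ hfcont.intervalIntegrable a b
  have hfderiv : ∀ t, HasDerivAt f (-(I⁻¹ * B t)) t := fun t ↦
    ((hWderiv t).const_mul I⁻¹).const_sub 1
  have hf01 : ∀ t, 0 ≤ f t ∧ f t ≤ 1 := fun t ↦ by
    have h1 : 0 ≤ I⁻¹ * W t := mul_nonneg hcpos.le (hWnonneg t)
    have h2 : I⁻¹ * W t ≤ 1 := by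
      calc I⁻¹ * W t ≤ I⁻¹ * I := mul_le_mul_of_nonneg_left (hWle t) hcpos.le
        _ = 1 := hcI
    simp only [hf]
    constructor <;> linarith
  have hflow : ∀ t, t ≤ 1 / 10 → f t = 1 := fun t ht ↦ by simp [hf, hWlow t ht]
  have hfhigh : ∀ t, 9 / 10 ≤ t → f t = 0 := fun t ht ↦ by
    simp only [hf, hWhigh t ht, hcI, sub_self]
  have hfsymm : ∀ t, f (1 - t) = 1 - f t := fun t ↦ by
    have h := hWsymm t
    simp only [hf]
    have : W (1 - t) = I - W t := by linarith
    rw [this, mul_sub, hcI]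
  -- `∫₀¹ f = 1/2`
  have hfhalf : ∫ s in (0 : ℝ)..1, f s = 1 / 2 := by
    have h1 : ∫ s in (0 : ℝ)..1, f (1 - s) = ∫ s in (1 - 1 : ℝ)..(1 - 0), f s :=
      integral_comp_sub_left f 1
    rw [sub_self, sub_zero] at h1
    have h2 : ∫ s in (0 : ℝ)..1, f (1 - s) = ∫ s in (0 : ℝ)..1, ((1 : ℝ) - f s) :=
      integral_congr fun s _ ↦ hfsymm s
    have h3 : ∫ s in (0 : ℝ)..1, ((1 : ℝ) - f s) = (∫ _ in (0 : ℝ)..1, (1 : ℝ)) -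
        ∫ s in (0 : ℝ)..1, f s :=
      integral_sub (continuous_const.intervalIntegrable 0 1) (hfint 0 1)
    rw [h2, h3, integral_one] at h1
    linarith
  -- the profile `φ₁`
  set φ : ℝ → ℝ := fun t ↦ -(1 / 2) + ∫ s in (0 : ℝ)..t, f s with hφ
  have hφderiv : ∀ t, HasDerivAt φ (f t) t := fun t ↦
    (hfcont.integral_hasStrictDerivAt 0 t).hasDerivAt.const_add _
  have hderivφ : deriv φ = f := funext fun t ↦ (hφderiv t).deriv
  have hφsmooth : ContDiff ℝ ∞ φ :=
    contDiff_infty_iff_deriv.mpr ⟨fun t ↦ (hφderiv t).differentiableAt, by rwa [hderivφ]⟩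
  have hderiv2φ : ∀ t, deriv (deriv φ) t = -(I⁻¹ * B t) := fun t ↦ by
    rw [hderivφ]
    exact (hfderiv t).deriv
  have hφsub : ∀ t t', φ t' - φ t = ∫ s in t..t', f s := fun t t' ↦ by
    simp only [hφ, add_sub_add_left_eq_sub]
    exact integral_interval_sub_left (hfint 0 t') (hfint 0 t)
  have hφmono : ∀ t t', t ≤ t' → φ t ≤ φ t' := fun t t' htt' ↦ by
    have := hφsub t t'
    have h0 : 0 ≤ ∫ s in t..t', f s := integral_nonneg htt' fun u _ ↦ (hf01 u).1
    linarith
  have hφ0 : φ 0 = -(1 / 2) := by simp [hφ]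
  have hφlow : ∀ t, t ≤ 1 / 10 → φ t = t - 1 / 2 := fun t ht ↦ by
    have h1 : ∫ s in (0 : ℝ)..t, f s = ∫ _ in (0 : ℝ)..t, (1 : ℝ) := by
      refine integral_congr fun s hs ↦ ?_
      rcases mem_uIcc.mp hs with ⟨_, hst⟩ | ⟨_, hs0⟩
      · exact hflow s (hst.trans ht)
      · exact hflow s (by linarith)
    simp only [hφ, h1, integral_one]
    ring
  have hφhigh : ∀ t, 9 / 10 ≤ t → φ t = 0 := fun t ht ↦ by
    have h1 : (∫ s in (0 : ℝ)..1, f s) + ∫ s in (1 : ℝ)..t, f s = ∫ s in (0 : ℝ)..t, f s :=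
      integral_add_adjacent_intervals (hfint _ _) (hfint _ _)
    have h2 : ∫ s in (1 : ℝ)..t, f s = 0 := by
      rw [integral_congr (g := fun _ ↦ (0 : ℝ)) ?_, intervalIntegral.integral_zero]
      intro s hs
      rcases mem_uIcc.mp hs with ⟨h1s, _⟩ | ⟨hts, _⟩
      · exact hfhigh s (by linarith)
      · exact hfhigh s (ht.trans hts)
    simp only [hφ]
    rw [← h1, h2, hfhalf]
    norm_num
  have hφbounds : ∀ t, 0 ≤ t → -(1 / 2) ≤ φ t ∧ φ t ≤ 0 := fun t ht ↦ by
    refine ⟨hφ0 ▸ hφmono 0 t ht, ?_⟩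
    by_cases ht' : 9 / 10 ≤ t
    · rw [hφhigh t ht']
    · exact (hφmono t (9 / 10) (by linarith)).trans_eq (hφhigh _ le_rfl)
  refine ⟨φ, hφsmooth, hφlow, hφhigh, hφbounds, fun t ↦ ?_, fun t ↦ ?_, fun t ht ↦ ?_⟩
  · rw [hderivφ]; exact hf01 t
  · rw [hderiv2φ t]
    have h0 := (hB01 t).1
    have h1 := (hB01 t).2
    constructor
    · have : I⁻¹ * B t ≤ 2 * 1 := mul_le_mul hcle h1 h0 (by norm_num)
      linarith
    · have : 0 ≤ I⁻¹ * B t := mul_nonneg hcpos.le h0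
      linarith
  · refine ⟨?_, ?_⟩
    · rw [hderivφ]
      exact hfhigh t ht
    · rw [hderiv2φ t, hBhigh t ht]
      simp

end BaerHanke

end Literature.Geometry.Riemannian

end
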